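import Summits.CriticalPhenomena.PercolationContinuityZ3.Theorems.Transplant.KNLevelsStepII
import Summits.CriticalPhenomena.PercolationContinuityZ3.Theorems.Transplant.KNLevelsStepV
import HarnessLib

/-!
# F6 (generic), part 4 — Kozma–Nitzan Lemma 10 ASSEMBLED over the levels of any locally finite graph, from per-level seed/cube kits
# (BLUEPRINT-I-PHI §3 Φ7; generalises `L/KozmaNitzanTargetLemma.lean` ll. 2107–2338, `targetLemma_avoiding`, from `zdGraph d` to a graph
# `G` with a nested family of finite vertex sets)

builds on p205010 (kernel theorem, internal audit signed; external expert review pending) — nothing in this file uses p205010 (the gluing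
hypothesis is a parameter `hC`; the unconditional `ℤ^d`-closure `CSH.kozmaNitzan_conjecture3_holds` is applied in a separate file).
Lane `prim-bschramm`, seat `prim-bschramm-p2` (task F6 = Target Lemma Steps III–V + assembly); helper file (`--supports
stmt-CriticalPhenomena-4575`), on p3's `KNLevelsDefs`/`KNLevelsLocality`/`KNLevelsStepII`/`KNLevelsStepIV` and this seat's
`KNLevelsStepIII`/`KNLevelsStepV`.

THE SHAPE.  Kozma–Nitzan's proof of Lemma 10 (arXiv:2401.12397 §4 pp. 17–22) splits into a GRAPH-FREE skeleton — Step I (constants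
`δ_{C3}, δ`), Step II (a level with `≥ N` contacts among `≥ (1-p)^{-ΔN}/δ` levels), Step III ((19): one of `k` disjoint seeds is open),
Step V (averaging (26), good patterns, gluing) — and GEOMETRIC inputs entering only through Step IV at each contact: a cube in the shell
behind the contact whose face is reached by the seed, with the uniqueness zone (Lemma 7), the linked face (Lemma 9) and the target route
(hittability, the definition of a target) each of probability `> 1 - δ²`.  This file proves the skeleton ONCE over the levels of `G`:
**`LHyp.targetLemma_of_kit`** (one level: kit ⟹ `P(o ↔ T) > 1 - ε` from `P(≥ N contacts) > 1 - 2δ`) and **`targetLemma_of_kits`**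
(for every `ε > 0` a `δ > 0` depending only on `ε` and the gluing hypothesis, such that: levels `[j₀, j₁]` with
`(1-p)^{-ΔN} ≤ δ·#levels`, a KIT at every level — seed data `σ` (`SHyp`, `σ.N ≤ N`, `(1 - p^{sB})^k ≤ δ`), a shell `S ⊆ B⟨j⟩ ∩ D` avoided by
the seeds and containing the faces, and the Step-IV conclusion `P(some u ∈ face x is a D-reliable relay | E(S)) ≥ 1 - 3δ` for every candidate
contact — and `P(o ↔ B) > 1 - δ` give `P(o ↔ T) > 1 - ε`).  The instances (`ℤ^d` regression: KN's boxes/plaquettes/cubes; `X □ ℤ²`: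
prisms, fibre-ball plaquettes at macro contacts, D₄-pieces) only have to BUILD kits, i.e. discharge Step IV per contact by p3's `stepIV_in`
from their Lemma 7 / Lemma 9 / hittability inputs at the scales the returned `δ` dictates (KN's order of constants, BLUEPRINT §2).

[cite: KozmaNitzan2024, §4 Lemma 10 (pp. 17–22); p. 16 (targets); p. 36 (Question 9, the graph H = G - o) — the ℤ^d model]
[cite: GrimmettPercolation1999, §7.2]
-/

noncomputable section

open MeasureTheory ProbabilityTheory
open scoped ENNReal

namespace Summit.CriticalPhenomena.PercolationContinuityZ3.Theorems

namespace Transplant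

namespace KNLevels

open Literature.Probability.Percolation Literature.Probability.LatticeModels SimpleGraph

variable {V : Type*} [DecidableEq V] {G : SimpleGraph V} [G.LocallyFinite]

namespace LHyp

variable {L : LData G} {W : Sym2 V → unitInterval} {p : unitInterval} {D : Finset V} {R : ℕ}
variable (hL : LHyp L W p D R)
include hL

/-- **Lemma 10 at one level, from a kit** (Steps III–V composed; KN pp. 19–22 with `Rg = D ∌ o`): at a level `j ≤ R` carrying `≥ N`
contacts with probability `> 1 - 2δ`, seed data `σ` with the Step-III axioms, `σ.N ≤ N` and `(1 - p^{sB})^k ≤ δ`, a shell `S ⊆ B⟨j⟩ ∩ D`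
avoided by every seed and containing every face, and the Step-IV estimate "with probability `≥ 1 - 3δ` some `u ∈ face x` satisfies
`P(u ↔ T inside D | ω|_{E(S)}) > 1 - δ`" for every candidate contact, the gluing hypothesis (constants `ε ≤ 1`, `δ ≤ δc`, `3δ ≤ 1`,
`12δ ≤ ε·δc`, avoiding form with region `D`) gives `P(o ↔ T) > 1 - ε`. [cite: KozmaNitzan2024, §4 Lemma 10 (pp. 19–22)] -/
theorem targetLemma_of_kit [Countable V] {σ : SData V} {j N : ℕ} (hσ : SHyp L j σ) (hj : j ≤ R) (hN : σ.N ≤ N)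
    {S T : Finset V} (hSX : S ⊆ L.X j) (hSD : S ⊆ D)
    (hSseed : ∀ x ∈ σ.K, ∀ e ∈ σ.seed x, e ∉ wireSet (↑S : Set V)) (hUS : ∀ x ∈ σ.K, σ.face x ⊆ S)
    (hTD : T ⊆ D) (hTne : T.Nonempty)
    {ε δ δc : ℝ} (hε : 0 < ε) (hε1 : ε ≤ 1) (hδ : 0 < δ) (hδc : δ ≤ δc) (h3δ : 3 * δ ≤ 1) (h12 : 12 * δ ≤ ε * δc)
    (hII : 1 - 2 * δ < (prodBernoulli W).real {ω | N ≤ (L.Kont j ω).card})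
    (hIII : (1 - (p : ℝ) ^ σ.sB) ^ σ.k ≤ δ)
    (hIV : ∀ x ∈ σ.K,
      1 - 3 * δ ≤ (prodBernoulli W).real {ω | ∃ u ∈ σ.face x,
        1 - δ < (prodBernoulli (pinW W (wireSet (↑S : Set V)) ω)).real (⋃ t ∈ T, openConnIn (↑D : Set V) u t)})
    (hC3 : ∀ (w : Sym2 V → unitInterval) (Sf : Finset V), (∀ e : Sym2 V, (∃ x ∈ e, x ∉ Sf) → w e = 0) →
      ∀ (A T' : Finset V) (o : V) (Rg : Set V), A ⊆ Sf → T' ⊆ Sf → o ∈ Sf → T'.Nonempty → o ∉ Rg →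
        1 - δc < (prodBernoulli w).real (⋃ a ∈ A, openConn o a) →
          (∀ a ∈ A, 1 - δc < (prodBernoulli w).real (⋃ t ∈ T', openConnIn Rg a t)) →
            1 - ε / 2 < (prodBernoulli w).real (⋃ t ∈ T', openConn o t)) :
    1 - ε < (prodBernoulli W).real (⋃ t ∈ T, openConn L.o t) := by
  -- Step II's output in the `Fail` form for `σ.N ≤ N`
  have hII' : 1 - 2 * δ < (prodBernoulli W).real (L.Fail σ.N j)ᶜ := by
    refine hII.trans_le (measureReal_mono (fun ω hω => ?_) (measure_ne_top _ _))
    rw [LData.compl_Fail_eq]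
    exact hN.trans hω
  -- the gluing hypothesis in the required form: source `o ∉ D`, relays reliable to `T` inside `D`
  have hC3' : ∀ (w : Sym2 V → unitInterval), FinSupp w L.Sfin → ∀ (A : Finset V), A ⊆ L.Sfin →
      1 - δc < (prodBernoulli w).real (⋃ a ∈ A, openConn L.o a) →
      (∀ a ∈ A, 1 - δc < (prodBernoulli w).real (⋃ t ∈ T, openConnIn (↑D : Set V) a t)) →
      1 - ε / 2 < (prodBernoulli w).real (⋃ t ∈ T, openConn L.o t) := by
    intro w hw A hA hoA haT
    exact hC3 w L.Sfin hw.zero A T L.o (↑D : Set V) hA (hTD.trans hL.DS) hL.o_mem hTne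
      (fun h => hL.o_not (Finset.mem_coe.1 h)) hoA haT
  exact hL.stepV_in (Rg := (↑D : Set V)) hσ hj hSX hSD hSseed hε hε1 hδ hδc h3δ h12 hII' hIII hUS hIV hC3'

end LHyp

/-- **Kozma–Nitzan's Lemma 10 over the levels of `G`, from per-level kits** (Steps I–V assembled; the graph-free skeleton of KN pp. 17–22).
Assume the gluing hypothesis in the avoiding form (relays reliable to the target inside a region not containing the source; Conjecture 3
implies it, and so does its `H = G - o` form of KN's Question 9), `p < 1`, degrees `≤ Δ`, `V` countable.  For every `ε > 0` there is
`δ ∈ (0, 1]` such that: for every level data `L` with hypotheses `LHyp L W p D R`, target `∅ ≠ T ⊆ D`, contact count `N` and level range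
`[j₀, j₁]`, `j₁ ≤ R`, with `(1-p)^{-ΔN} ≤ δ · #[j₀, j₁]`, if EVERY level `j ∈ [j₀, j₁]` carries a kit — seed data `σ` (`SHyp L j σ`, `σ.N ≤ N`,
`(1 - p^{σ.sB})^{σ.k} ≤ δ`), a shell `S ⊆ B⟨j⟩ ∩ D` avoided by the seeds and containing the faces, and for every candidate contact `x ∈ σ.K`
the Step-IV conclusion `P(∃ u ∈ face x, P(u ↔ T inside D | ω|_{E(S)}) > 1 - δ) ≥ 1 - 3δ` — then
`P_W(o ↔ B) > 1 - δ ⟹ P_W(o ↔ T) > 1 - ε`.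
Proof: Step I (`δ_{C3}` at `ε/2`, `δ := ε·min(δ_{C3},1)/12`), Step II (p3's `LHyp.stepII`) picks the level, `LHyp.targetLemma_of_kit`.
[cite: KozmaNitzan2024, §4 Lemma 10 (pp. 17–22); p. 36 (Question 9)] -/
theorem targetLemma_of_kits [Countable V] {Δ : ℕ} (hΔ : ∀ x, G.degree x ≤ Δ)
    (hC : ∀ ε : ℝ, 0 < ε → ∃ δ : ℝ, 0 < δ ∧ ∀ (w : Sym2 V → unitInterval) (Sf : Finset V),
      (∀ e : Sym2 V, (∃ x ∈ e, x ∉ Sf) → w e = 0) →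
      ∀ (A T : Finset V) (o : V) (Rg : Set V),
        A ⊆ Sf → T ⊆ Sf → o ∈ Sf → T.Nonempty → o ∉ Rg →
        1 - δ < (prodBernoulli w).real (⋃ a ∈ A, openConn o a) →
          (∀ a ∈ A, 1 - δ < (prodBernoulli w).real (⋃ t ∈ T, openConnIn Rg a t)) →
            1 - ε < (prodBernoulli w).real (⋃ t ∈ T, openConn o t))
    (p : unitInterval) (hp1 : (p : ℝ) < 1) {ε : ℝ} (hε : 0 < ε) :
    ∃ δ : ℝ, 0 < δ ∧ δ ≤ 1 ∧ ∀ (L : LData G) (W : Sym2 V → unitInterval) (D T : Finset V) (R N j₀ j₁ : ℕ),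
      LHyp L W p D R → j₁ ≤ R → T ⊆ D → T.Nonempty →
      1 / (1 - (p : ℝ)) ^ (Δ * N) ≤ δ * ((Finset.Icc j₀ j₁).card : ℝ) →
      (∀ j ∈ Finset.Icc j₀ j₁, ∃ (σ : SData V) (S : Finset V), SHyp L j σ ∧ σ.N ≤ N ∧
        (1 - (p : ℝ) ^ σ.sB) ^ σ.k ≤ δ ∧ S ⊆ L.X j ∧ S ⊆ D ∧
        (∀ x ∈ σ.K, ∀ e ∈ σ.seed x, e ∉ wireSet (↑S : Set V)) ∧ (∀ x ∈ σ.K, σ.face x ⊆ S) ∧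
        (∀ x ∈ σ.K, 1 - 3 * δ ≤ (prodBernoulli W).real {ω | ∃ u ∈ σ.face x,
          1 - δ < (prodBernoulli (pinW W (wireSet (↑S : Set V)) ω)).real (⋃ t ∈ T, openConnIn (↑D : Set V) u t)})) →
      1 - δ < (prodBernoulli W).real L.reachB →
        1 - ε < (prodBernoulli W).real (⋃ t ∈ T, openConn L.o t) := by
  classical
  -- trivial when `ε > 1`
  rcases le_or_gt ε 1 with hε1 | hε1
  swap
  · refine ⟨1, one_pos, le_rfl, fun L W D T R N j₀ j₁ _ _ _ _ _ _ _ => ?_⟩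
    exact lt_of_lt_of_le (by linarith) measureReal_nonneg
  -- Step I: the constants `δ_{C3}`, `δ`
  obtain ⟨δ₀, hδ₀, hC3⟩ := hC (ε / 2) (half_pos hε)
  set δc : ℝ := min δ₀ 1 with hδc
  have hδc0 : 0 < δc := lt_min hδ₀ one_pos
  have hδc1 : δc ≤ 1 := min_le_right _ _
  set δ : ℝ := ε * δc / 12 with hδdef
  have hδpos : 0 < δ := by positivity
  have hδc' : δ ≤ δc := by rw [hδdef]; nlinarith
  have h3δ : 3 * δ ≤ 1 := by rw [hδdef]; nlinarith
  have h12 : 12 * δ ≤ ε * δc := by rw [hδdef]; linarith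
  have hδ1 : δ ≤ 1 := by linarith
  refine ⟨δ, hδpos, hδ1, fun L W D T R N j₀ j₁ hL hj₁ hTD hTne hJ hkits hreach => ?_⟩
  -- Step II: a level with many contacts
  obtain ⟨j, hjJ, hII⟩ := hL.stepII hΔ hp1 (N := N) hj₁ hJ hreach
  have hjR : j ≤ R := (Finset.mem_Icc.1 hjJ).2.trans hj₁
  -- the kit at that level
  obtain ⟨σ, S, hσ, hN, hIII, hSX, hSD, hSseed, hUS, hIV⟩ := hkits j hjJ
  -- the gluing hypothesis at `δc ≤ δ₀`
  have hC3' : ∀ (w : Sym2 V → unitInterval) (Sf : Finset V), (∀ e : Sym2 V, (∃ x ∈ e, x ∉ Sf) → w e = 0) →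
      ∀ (A T' : Finset V) (o : V) (Rg : Set V), A ⊆ Sf → T' ⊆ Sf → o ∈ Sf → T'.Nonempty → o ∉ Rg →
        1 - δc < (prodBernoulli w).real (⋃ a ∈ A, openConn o a) →
          (∀ a ∈ A, 1 - δc < (prodBernoulli w).real (⋃ t ∈ T', openConnIn Rg a t)) →
            1 - ε / 2 < (prodBernoulli w).real (⋃ t ∈ T', openConn o t) := by
    intro w Sf hw A T' o Rg hA hT' ho hne hoRg hoA haT
    have hle : 1 - δ₀ ≤ 1 - δc := by linarith [min_le_left δ₀ 1]
    exact hC3 w Sf hw A T' o Rg hA hT' ho hne hoRg (hle.trans_lt hoA) fun a ha => hle.trans_lt (haT a ha)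
  -- Steps III–V
  exact hL.targetLemma_of_kit hσ hjR hN hSX hSD hSseed hUS hTD hTne hε hε1 hδpos hδc' h3δ h12 hII hIII hIV hC3'

omit [DecidableEq V] [G.LocallyFinite] in
/-- **The avoiding form follows from the plain (Conjecture 3) form** of the gluing hypothesis (relays reliable to `T` anywhere): a relay
reliable inside a region is reliable. [cite: KozmaNitzan2024, Conjecture 3 (p. 15)] -/
theorem avoidingGluing_of_gluing
    (hC : ∀ ε : ℝ, 0 < ε → ∃ δ : ℝ, 0 < δ ∧ ∀ (w : Sym2 V → unitInterval) (Sf : Finset V),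
      (∀ e : Sym2 V, (∃ x ∈ e, x ∉ Sf) → w e = 0) →
      ∀ (A T : Finset V) (o : V), A ⊆ Sf → T ⊆ Sf → o ∈ Sf → T.Nonempty →
        1 - δ < (prodBernoulli w).real (⋃ a ∈ A, openConn o a) →
          (∀ a ∈ A, 1 - δ < (prodBernoulli w).real (⋃ t ∈ T, openConn a t)) →
            1 - ε < (prodBernoulli w).real (⋃ t ∈ T, openConn o t))
    (ε : ℝ) (hε : 0 < ε) :
    ∃ δ : ℝ, 0 < δ ∧ ∀ (w : Sym2 V → unitInterval) (Sf : Finset V),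
      (∀ e : Sym2 V, (∃ x ∈ e, x ∉ Sf) → w e = 0) →
      ∀ (A T : Finset V) (o : V) (Rg : Set V),
        A ⊆ Sf → T ⊆ Sf → o ∈ Sf → T.Nonempty → o ∉ Rg →
        1 - δ < (prodBernoulli w).real (⋃ a ∈ A, openConn o a) →
          (∀ a ∈ A, 1 - δ < (prodBernoulli w).real (⋃ t ∈ T, openConnIn Rg a t)) →
            1 - ε < (prodBernoulli w).real (⋃ t ∈ T, openConn o t) := by
  obtain ⟨δ, hδ, h⟩ := hC ε hε
  refine ⟨δ, hδ, fun w Sf hw A T o Rg hA hT ho hne _ hoA haT => h w Sf hw A T o hA hT ho hne hoA ?_⟩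
  intro a ha
  refine (haT a ha).trans_le (measureReal_mono (Set.iUnion₂_mono fun t _ ω hω => ?_) (measure_ne_top _ _))
  rw [DCT16.mem_openConnIn_iff_pathIn] at hω
  exact reachable_of_pathIn hω

end KNLevels

end Transplant

end Summit.CriticalPhenomena.PercolationContinuityZ3.Theorems

end
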